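import Summits.AtomisticToContinuum.Crystallization.Theorems.FrustratedLawDichotomyStrainedPatchHomCurvLeafL2
import Summits.AtomisticToContinuum.Crystallization.Theorems.FrustratedLawDichotomyStrainedPatchHomSlopePath

/-!
# The PER-LABEL centred slope estimate (kernel remainder constant + real lemma) of the centred slope leaf `slopeCheckC`

decomp-a2c hand-1 g28 (crux `AperiodicFrustratedLawGap`, stmt-AtomisticToContinuum-27623; `(H) HomFloor (1/625)`, hcp half; lever (C), critic
row 1083 (B)).  For a centred label `b` of the box `(c, w)` (v2 tube `…HomCurvCentreKit2.tube2`, data of `…HomCurvLeafL2.ttOf2` /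
`…HomCurvLeafL.abOf`), every `U, η` in the box and every direction `Δ`:

  `|β(‖c_b‖)⟪c_b,Δ⟫ − β₀⟪p_b,Δ⟫ − (α₀⟪p_b,d_b⟫⟪p_b,Δ⟫ + β₀⟪d_b,Δ⟫)| ≤ (KSl/SC)/2 · (nd2S2/SC) · ‖Δ‖`

with the canonical centre values `α₀ = α(ρ₀) ∈ A0of`, `β₀ = β(ρ₀) ∈ B0of` (`ρ₀ = ‖p_b‖`), `c_b = latPt U hexFrame b + U(hcpShift + η)`, `p_b = cenPt c b`,
`d_b = c_b − p_b`, and the kernel remainder constant `KSl = kSlopeS tt tube2 ≥ SC·sup_tube (|α′ρ + α|·ρ + 3|α|ρ)` (§1).  Real side: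
`…HomSlopePath.slopeForm_secondOrder` with `B = β`, `B₁ = αρ`, `B₂ = α′ρ + α` on the bump / Lennard-Jones regime (`…HomCurvRegime3`).

* §1 `kSlopeS`, `kSlope_of_mem`;  §2 `label_slope_bump2`, `label_slope_lj2`;  §3 flat accessors `slopeLabelOK`, `KSlof` and the dispatcher ★★ `label_slope2`.

Kernel definitions + soundness; 0 sorry; standard axioms; no instances / notation / `#eval`.  `--supports stmt-AtomisticToContinuum-27623`.
-/

noncomputable section

namespace Summit.AtomisticToContinuum.Crystallization.Theorems.FrustratedLawDichotomyStrainedPatchHomSlopeCentre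

open scoped BigOperators RealInnerProductSpace
open Literature.Analysis.ValidatedNumerics.Numerics
open Summit.AtomisticToContinuum.Crystallization.Theorems.ChargedEnergyGapNegative (E3)
open Summit.AtomisticToContinuum.Crystallization.Theorems.FrustratedLawDichotomySchurCut (effPot w₄₅ ω₄)
open Summit.AtomisticToContinuum.Crystallization.Theorems.FrustratedLawDichotomyStrainedPatchHomSplit (latPt hexFrame hcpShift)
open Summit.AtomisticToContinuum.Crystallization.Theorems.FrustratedLawDichotomyStrainedPatchHomEntryGramHcp (dot3 mem_dot3)
open Summit.AtomisticToContinuum.Crystallization.Theorems.FrustratedLawDichotomyStrainedPatchHomCurvCoeff (wFI mem_wFI coeffFI2 mem_coeffFI2 rhoFI mem_rhoFI)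
open Summit.AtomisticToContinuum.Crystallization.Theorems.FrustratedLawDichotomyStrainedPatchHomCurvCoeff3
  (ljTripleFI bumpTripleFI mem_ljTripleFI mem_bumpTripleFI)
open Summit.AtomisticToContinuum.Crystallization.Theorems.FrustratedLawDichotomyStrainedPatchHomCurvRegime3
open Summit.AtomisticToContinuum.Crystallization.Theorems.FrustratedLawDichotomyStrainedPatchHomCurvCentreKit
open Summit.AtomisticToContinuum.Crystallization.Theorems.FrustratedLawDichotomyStrainedPatchHomCurvLeafL (dflt3 abOf A0of B0of)
open Summit.AtomisticToContinuum.Crystallization.Theorems.FrustratedLawDichotomyStrainedPatchHomCurvLeafL2 (ttOf2)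
open Summit.AtomisticToContinuum.Crystallization.Theorems.FrustratedLawDichotomyStrainedPatchHomSlopePath (slopeForm_secondOrder)
open Summit.AtomisticToContinuum.Crystallization.Theorems.FrustratedLawDichotomyStrainedPatchTaylorLeaves (junctions)
open Summit.AtomisticToContinuum.Crystallization.Theorems.FrustratedLawDichotomyStrainedPatchTaylorChord (segR)

/-! ## §1. The kernel remainder constant of the slope form -/

/-- ★ Scaled slope remainder constant over a radius tube `T` from the `(α, α′ρ, α″ρ²)` enclosure `tt`:
`cdiv (T.hi · (|α′ρ + α|_hi + 3|α|_hi)) SC ≥ SC · sup_{ρ ∈ T} (|α′ρ + α|·ρ + 3|α|ρ)`. -/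
def kSlopeS (tt : FI × FI × FI) (T : FI) : ℤ := cdiv (T.hi * ((tt.2.1.add tt.1).absHi + 3 * tt.1.absHi)) SC

/-- ★ The remainder constant dominates `|A1·r + A|·r + 3|A·r|` for `A ∈ tt.1`, `A1·r ∈ tt.2.1`, `0 < r ≤ T.hi/SC`. [folklore] -/
theorem kSlope_of_mem {A A1 r : ℝ} (hr : 0 < r) {tt : FI × FI × FI} {T : FI} (hT : r * SC ≤ (T.hi : ℝ))
    (h0 : FI.mem A tt.1) (h1 : FI.mem (A1 * r) tt.2.1) :
    |A1 * r + A| * r + 3 * |A * r| ≤ ((kSlopeS tt T : ℤ) : ℝ) / SC := by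
  have hS : (0 : ℝ) < SC := by norm_num [SC]
  have hsum : FI.mem (A1 * r + A) (tt.2.1.add tt.1) := FI.mem_add h1 h0
  have ha : |A1 * r + A| * SC ≤ ((tt.2.1.add tt.1).absHi : ℝ) := FI.abs_le_absHi hsum
  have hb : |A| * SC ≤ (tt.1.absHi : ℝ) := FI.abs_le_absHi h0
  have hA3 : 3 * |A * r| = 3 * |A| * r := by rw [abs_mul, abs_of_pos hr]; ring
  rw [hA3]
  -- `(|A1 r + A| + 3|A|)·r ≤ (absHi₁ + 3 absHi₀)/SC · T.hi/SC`
  have h1' : |A1 * r + A| ≤ ((tt.2.1.add tt.1).absHi : ℝ) / SC := by rw [le_div_iff₀ hS]; exact ha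
  have h2' : |A| ≤ (tt.1.absHi : ℝ) / SC := by rw [le_div_iff₀ hS]; exact hb
  have hr' : r ≤ (T.hi : ℝ) / SC := by rw [le_div_iff₀ hS]; exact hT
  have hnn : 0 ≤ ((tt.2.1.add tt.1).absHi : ℝ) / SC + 3 * ((tt.1.absHi : ℝ) / SC) := by
    have : (0 : ℝ) ≤ |A1 * r + A| := abs_nonneg _
    have : (0 : ℝ) ≤ |A| := abs_nonneg _
    linarith
  have step : |A1 * r + A| * r + 3 * |A| * r ≤ (((tt.2.1.add tt.1).absHi : ℝ) / SC + 3 * ((tt.1.absHi : ℝ) / SC)) * ((T.hi : ℝ) / SC) := by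
    have e : |A1 * r + A| * r + 3 * |A| * r = (|A1 * r + A| + 3 * |A|) * r := by ring
    rw [e]
    exact mul_le_mul (by linarith) hr' hr.le hnn
  have hcd := div_le_cdiv (a := T.hi * ((tt.2.1.add tt.1).absHi + 3 * tt.1.absHi)) (b := (SC : ℤ)) (by exact_mod_cast hS)
  have e2 : (((tt.2.1.add tt.1).absHi : ℝ) / SC + 3 * ((tt.1.absHi : ℝ) / SC)) * ((T.hi : ℝ) / SC) =
      ((T.hi * ((tt.2.1.add tt.1).absHi + 3 * tt.1.absHi) : ℤ) : ℝ) / (SC : ℤ) / SC := by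
    push_cast; field_simp
  rw [e2] at step
  refine step.trans ?_
  rw [kSlopeS]
  exact div_le_div_of_nonneg_right (by exact_mod_cast hcd) hS.le

/-! ## §2. The two regime branches -/

/-- ★ **Bump branch** of the per-label centred slope estimate. [folklore chaining: `slopeForm_secondOrder` on the v2 tube] -/
theorem label_slope_bump2 {c w : (Fin 3 × Fin 3) ⊕ Fin 3 → ℤ} {b : Fin 3 → ℤ} (hreg : regBump (tube2 c w b) = true)
    {tt : FI × FI × FI} {ab : FI × FI}
    (htt : bumpTripleFI ((tube2 c w b).mul (tube2 c w b)) (wFI (tube2 c w b)) = some tt)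
    (hab : coeffFI2 (dot3 (cenVec c b) (cenVec c b)) = some ab)
    (U : E3 →L[ℝ] E3)
    (hbox : ∀ ab : Fin 3 × Fin 3, |(U (EuclideanSpace.single ab.2 (1 : ℝ))) ab.1 - (c (Sum.inl ab) : ℝ) / SC| ≤ (w (Sum.inl ab) : ℝ) / SC)
    (η : E3) (hη : ∀ i : Fin 3, |η i - (c (Sum.inr i) : ℝ) / SC| ≤ (w (Sum.inr i) : ℝ) / SC) (Δ : E3) :
    FI.mem ((deriv (deriv (effPot w₄₅ ω₄ (3 / 400))) ‖cenPt c b‖ - deriv (effPot w₄₅ ω₄ (3 / 400)) ‖cenPt c b‖ / ‖cenPt c b‖) / ‖cenPt c b‖ ^ 2) ab.1 ∧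
      FI.mem (deriv (effPot w₄₅ ω₄ (3 / 400)) ‖cenPt c b‖ / ‖cenPt c b‖) ab.2 ∧
      |deriv (effPot w₄₅ ω₄ (3 / 400)) ‖latPt U hexFrame b + U (hcpShift + η)‖ / ‖latPt U hexFrame b + U (hcpShift + η)‖ *
            ⟪latPt U hexFrame b + U (hcpShift + η), Δ⟫ -
          deriv (effPot w₄₅ ω₄ (3 / 400)) ‖cenPt c b‖ / ‖cenPt c b‖ * ⟪cenPt c b, Δ⟫ -
          ((deriv (deriv (effPot w₄₅ ω₄ (3 / 400))) ‖cenPt c b‖ - deriv (effPot w₄₅ ω₄ (3 / 400)) ‖cenPt c b‖ / ‖cenPt c b‖) / ‖cenPt c b‖ ^ 2 *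
              ⟪cenPt c b, latPt U hexFrame b + U (hcpShift + η) - cenPt c b⟫ * ⟪cenPt c b, Δ⟫ +
            deriv (effPot w₄₅ ω₄ (3 / 400)) ‖cenPt c b‖ / ‖cenPt c b‖ * ⟪latPt U hexFrame b + U (hcpShift + η) - cenPt c b, Δ⟫)| ≤
        ((kSlopeS tt (tube2 c w b) : ℤ) : ℝ) / SC / 2 * ((nd2S2 c w b : ℝ) / SC) * ‖Δ‖ := by
  have hS : (0 : ℝ) < SC := by norm_num [SC]
  obtain ⟨hTlo, hThi⟩ := of_decide_eq_true hreg
  set T := tube2 c w b with hT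
  set p := cenPt c b with hp
  set cb := latPt U hexFrame b + U (hcpShift + η) with hcb
  set d := cb - p with hd
  set aa : ℝ := (T.lo : ℝ) / SC with haa
  set bb : ℝ := (T.hi : ℝ) / SC with hbb
  have ha : 0 < aa := div_pos (by exact_mod_cast hTlo) hS
  have hb : bb < 8 / 5 := by
    rw [hbb, div_lt_iff₀ hS]
    have : ((5 * T.hi : ℤ) : ℝ) < ((8 * (SC : ℤ) : ℤ) : ℝ) := by exact_mod_cast hThi
    push_cast at this; linarith
  have hreg' : ∀ r, aa < r → r < bb → 0 < r ∧ r < 8 / 5 := fun r h1 h2 => ⟨ha.trans h1, h2.trans hb⟩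
  have htube : ∀ t ∈ Set.Icc (0 : ℝ) 1, aa < segR p d t ∧ segR p d t < bb := fun t ht => by
    have := tube2_mem U hbox η hη b ht
    simpa [segR, hp, hd, hcb] using this
  set K : ℝ := ((kSlopeS tt T : ℤ) : ℝ) / SC with hKdef
  have hSF := slopeForm_secondOrder (B := fun s => deriv (effPot w₄₅ ω₄ (3 / 400)) s / s) (B₁ := fun s => alphaB s * s)
    (B₂ := fun s => alpha1B s * s + alphaB s) (K := K) (p := p) (d := d) (Δ := Δ) ha htube
    (fun r h1 h2 => hasDerivAt_betaTrue_bump (hreg' r h1 h2).1 (hreg' r h1 h2).2)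
    (fun r h1 h2 => hasDerivAt_alphaB_mul (hreg' r h1 h2).1.ne')
    (fun r h1 h2 => by
      have hr := hreg' r h1 h2
      have hmT : FI.mem r T := mem_of_strict h1 h2
      have hq2 : FI.mem (r ^ 2) (T.mul T) := by rw [sq]; exact FI.mem_mul hmT hmT
      obtain ⟨m0, m1, _⟩ := mem_bumpTripleFI hq2 (mem_wFI hmT) htt
      have hrT : r * SC ≤ (T.hi : ℝ) := hmT.2
      have key := kSlope_of_mem hr.1 hrT m0 m1
      simpa only using key)
  -- centre data
  have h0t := htube 0 (by simp)
  have hR0 : segR p d 0 = ‖p‖ := by simp [segR]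
  rw [hR0] at h0t
  have hρr := hreg' ‖p‖ h0t.1 h0t.2
  have hρne : ‖p‖ ≠ 0 := hρr.1.ne'
  have hJ : ‖p‖ ∉ junctions := not_mem_junctions_of (Or.inl hρr)
  have hQ0 := (mem_rho0 c b).1
  have hcoef := mem_coeffFI2 hρr.1 hJ hQ0 hab
  have hlink0 : (deriv (deriv (effPot w₄₅ ω₄ (3 / 400))) ‖p‖ - deriv (effPot w₄₅ ω₄ (3 / 400)) ‖p‖ / ‖p‖) / ‖p‖ ^ 2 = alphaB ‖p‖ :=
    alphaTrue_eq_bump hρr.1 hρr.2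
  refine ⟨hcoef.1, hcoef.2, ?_⟩
  have hpd : p + d = cb := by rw [hd]; abel
  simp only [hpd] at hSF
  -- `B₁(ρ₀)(⟪p,d⟫/ρ₀) = α₀⟪p,d⟫`
  have e1 : alphaB ‖p‖ * ‖p‖ * (⟪p, d⟫ / ‖p‖) =
      (deriv (deriv (effPot w₄₅ ω₄ (3 / 400))) ‖p‖ - deriv (effPot w₄₅ ω₄ (3 / 400)) ‖p‖ / ‖p‖) / ‖p‖ ^ 2 * ⟪p, d⟫ := by
    rw [hlink0]; field_simp
  rw [e1] at hSF
  have hK0 : 0 ≤ K := by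
    have h := kSlope_of_mem hρr.1 (show ‖p‖ * SC ≤ (T.hi : ℝ) from (mem_of_strict h0t.1 h0t.2).2)
      (mem_bumpTripleFI (by rw [sq]; exact FI.mem_mul (mem_of_strict h0t.1 h0t.2) (mem_of_strict h0t.1 h0t.2))
        (mem_wFI (mem_of_strict h0t.1 h0t.2)) htt).1
      (mem_bumpTripleFI (by rw [sq]; exact FI.mem_mul (mem_of_strict h0t.1 h0t.2) (mem_of_strict h0t.1 h0t.2))
        (mem_wFI (mem_of_strict h0t.1 h0t.2)) htt).2.1
    exact le_trans (by positivity) h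
  have hN : ‖d‖ ^ 2 ≤ (nd2S2 c w b : ℝ) / SC := by
    rw [le_div_iff₀ hS]; exact norm_sq_dVec2_le U hbox η hη b
  have hbound : K / 2 * ‖d‖ ^ 2 * ‖Δ‖ ≤ K / 2 * ((nd2S2 c w b : ℝ) / SC) * ‖Δ‖ :=
    mul_le_mul_of_nonneg_right (mul_le_mul_of_nonneg_left hN (by linarith)) (norm_nonneg _)
  exact hSF.trans (by simpa [hKdef] using hbound)

/-- ★ **Lennard-Jones branch** of the per-label centred slope estimate. [folklore chaining] -/
theorem label_slope_lj2 {c w : (Fin 3 × Fin 3) ⊕ Fin 3 → ℤ} {b : Fin 3 → ℤ} (hreg : regLJ (tube2 c w b) = true)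
    {tt : FI × FI × FI} {ab : FI × FI}
    (htt : ljTripleFI ((tube2 c w b).mul (tube2 c w b)) = some tt)
    (hab : coeffFI2 (dot3 (cenVec c b) (cenVec c b)) = some ab)
    (U : E3 →L[ℝ] E3)
    (hbox : ∀ ab : Fin 3 × Fin 3, |(U (EuclideanSpace.single ab.2 (1 : ℝ))) ab.1 - (c (Sum.inl ab) : ℝ) / SC| ≤ (w (Sum.inl ab) : ℝ) / SC)
    (η : E3) (hη : ∀ i : Fin 3, |η i - (c (Sum.inr i) : ℝ) / SC| ≤ (w (Sum.inr i) : ℝ) / SC) (Δ : E3) :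
    FI.mem ((deriv (deriv (effPot w₄₅ ω₄ (3 / 400))) ‖cenPt c b‖ - deriv (effPot w₄₅ ω₄ (3 / 400)) ‖cenPt c b‖ / ‖cenPt c b‖) / ‖cenPt c b‖ ^ 2) ab.1 ∧
      FI.mem (deriv (effPot w₄₅ ω₄ (3 / 400)) ‖cenPt c b‖ / ‖cenPt c b‖) ab.2 ∧
      |deriv (effPot w₄₅ ω₄ (3 / 400)) ‖latPt U hexFrame b + U (hcpShift + η)‖ / ‖latPt U hexFrame b + U (hcpShift + η)‖ *
            ⟪latPt U hexFrame b + U (hcpShift + η), Δ⟫ -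
          deriv (effPot w₄₅ ω₄ (3 / 400)) ‖cenPt c b‖ / ‖cenPt c b‖ * ⟪cenPt c b, Δ⟫ -
          ((deriv (deriv (effPot w₄₅ ω₄ (3 / 400))) ‖cenPt c b‖ - deriv (effPot w₄₅ ω₄ (3 / 400)) ‖cenPt c b‖ / ‖cenPt c b‖) / ‖cenPt c b‖ ^ 2 *
              ⟪cenPt c b, latPt U hexFrame b + U (hcpShift + η) - cenPt c b⟫ * ⟪cenPt c b, Δ⟫ +
            deriv (effPot w₄₅ ω₄ (3 / 400)) ‖cenPt c b‖ / ‖cenPt c b‖ * ⟪latPt U hexFrame b + U (hcpShift + η) - cenPt c b, Δ⟫)| ≤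
        ((kSlopeS tt (tube2 c w b) : ℤ) : ℝ) / SC / 2 * ((nd2S2 c w b : ℝ) / SC) * ‖Δ‖ := by
  have hS : (0 : ℝ) < SC := by norm_num [SC]
  obtain ⟨hTlo, hThi⟩ := of_decide_eq_true hreg
  set T := tube2 c w b with hT
  set p := cenPt c b with hp
  set cb := latPt U hexFrame b + U (hcpShift + η) with hcb
  set d := cb - p with hd
  set aa : ℝ := (T.lo : ℝ) / SC with haa
  set bb : ℝ := (T.hi : ℝ) / SC with hbb
  have ha : 8 / 5 < aa := by
    rw [haa, lt_div_iff₀ hS]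
    have : ((8 * (SC : ℤ) : ℤ) : ℝ) < ((5 * T.lo : ℤ) : ℝ) := by exact_mod_cast hTlo
    push_cast at this; linarith
  have ha0 : 0 < aa := lt_trans (by norm_num) ha
  have hb : bb < 3 := by
    rw [hbb, div_lt_iff₀ hS]
    have : ((T.hi : ℤ) : ℝ) < ((3 * (SC : ℤ) : ℤ) : ℝ) := by exact_mod_cast hThi
    push_cast at this; linarith
  have hreg' : ∀ r, aa < r → r < bb → 8 / 5 < r ∧ r < 3 := fun r h1 h2 => ⟨ha.trans h1, h2.trans hb⟩
  have htube : ∀ t ∈ Set.Icc (0 : ℝ) 1, aa < segR p d t ∧ segR p d t < bb := fun t ht => by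
    have := tube2_mem U hbox η hη b ht
    simpa [segR, hp, hd, hcb] using this
  set K : ℝ := ((kSlopeS tt T : ℤ) : ℝ) / SC with hKdef
  have hSF := slopeForm_secondOrder (B := fun s => deriv (effPot w₄₅ ω₄ (3 / 400)) s / s) (B₁ := fun s => alphaLJ s * s)
    (B₂ := fun s => alpha1LJ s * s + alphaLJ s) (K := K) (p := p) (d := d) (Δ := Δ) ha0 htube
    (fun r h1 h2 => hasDerivAt_betaTrue_lj (hreg' r h1 h2).1 (hreg' r h1 h2).2)
    (fun r h1 h2 => hasDerivAt_alphaLJ_mul (by linarith [(hreg' r h1 h2).1] : r ≠ 0))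
    (fun r h1 h2 => by
      have hr := hreg' r h1 h2
      have hr0 : 0 < r := lt_trans (by norm_num) hr.1
      have hmT : FI.mem r T := mem_of_strict h1 h2
      have hq2 : FI.mem (r ^ 2) (T.mul T) := by rw [sq]; exact FI.mem_mul hmT hmT
      obtain ⟨m0, m1, _⟩ := mem_ljTripleFI hq2 htt
      have hrT : r * SC ≤ (T.hi : ℝ) := hmT.2
      have key := kSlope_of_mem hr0 hrT m0 m1
      simpa only using key)
  -- centre data
  have h0t := htube 0 (by simp)
  have hR0 : segR p d 0 = ‖p‖ := by simp [segR]
  rw [hR0] at h0t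
  have hρr := hreg' ‖p‖ h0t.1 h0t.2
  have hρ0 : 0 < ‖p‖ := lt_trans (by norm_num) hρr.1
  have hρne : ‖p‖ ≠ 0 := hρ0.ne'
  have hJ : ‖p‖ ∉ junctions := not_mem_junctions_of (Or.inr hρr)
  have hQ0 := (mem_rho0 c b).1
  have hcoef := mem_coeffFI2 hρ0 hJ hQ0 hab
  have hlink0 : (deriv (deriv (effPot w₄₅ ω₄ (3 / 400))) ‖p‖ - deriv (effPot w₄₅ ω₄ (3 / 400)) ‖p‖ / ‖p‖) / ‖p‖ ^ 2 = alphaLJ ‖p‖ :=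
    alphaTrue_eq_lj hρr.1 hρr.2
  refine ⟨hcoef.1, hcoef.2, ?_⟩
  have hpd : p + d = cb := by rw [hd]; abel
  simp only [hpd] at hSF
  have e1 : alphaLJ ‖p‖ * ‖p‖ * (⟪p, d⟫ / ‖p‖) =
      (deriv (deriv (effPot w₄₅ ω₄ (3 / 400))) ‖p‖ - deriv (effPot w₄₅ ω₄ (3 / 400)) ‖p‖ / ‖p‖) / ‖p‖ ^ 2 * ⟪p, d⟫ := by
    rw [hlink0]; field_simp
  rw [e1] at hSF
  have hK0 : 0 ≤ K := by
    have hmT : FI.mem ‖p‖ T := mem_of_strict h0t.1 h0t.2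
    have hq2 : FI.mem (‖p‖ ^ 2) (T.mul T) := by rw [sq]; exact FI.mem_mul hmT hmT
    obtain ⟨m0, m1, _⟩ := mem_ljTripleFI hq2 htt
    have h := kSlope_of_mem hρ0 hmT.2 m0 m1
    exact le_trans (by positivity) h
  have hN : ‖d‖ ^ 2 ≤ (nd2S2 c w b : ℝ) / SC := by
    rw [le_div_iff₀ hS]; exact norm_sq_dVec2_le U hbox η hη b
  have hbound : K / 2 * ‖d‖ ^ 2 * ‖Δ‖ ≤ K / 2 * ((nd2S2 c w b : ℝ) / SC) * ‖Δ‖ :=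
    mul_le_mul_of_nonneg_right (mul_le_mul_of_nonneg_left hN (by linarith)) (norm_nonneg _)
  exact hSF.trans (by simpa [hKdef] using hbound)

/-! ## §3. Flat accessors and the dispatcher -/

/-- The label can be centred for the slope leaf (tube inside bump/LJ with an `(α, α′ρ, α″ρ²)` enclosure, centre coefficients available). -/
def slopeLabelOK (c w : (Fin 3 × Fin 3) ⊕ Fin 3 → ℤ) (b : Fin 3 → ℤ) : Bool := (ttOf2 c w b).isSome && (abOf c b).isSome

/-- Scaled slope remainder constant of the label. -/
def KSlof (c w : (Fin 3 × Fin 3) ⊕ Fin 3 → ℤ) (b : Fin 3 → ℤ) : ℤ := kSlopeS ((ttOf2 c w b).getD dflt3) (tube2 c w b)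

/-- ★★ **The per-label centred slope estimate from `slopeLabelOK`** (dispatch over the regime flag). [folklore chaining] -/
theorem label_slope2 {c w : (Fin 3 × Fin 3) ⊕ Fin 3 → ℤ} {b : Fin 3 → ℤ} (h : slopeLabelOK c w b = true) (U : E3 →L[ℝ] E3)
    (hbox : ∀ ab : Fin 3 × Fin 3, |(U (EuclideanSpace.single ab.2 (1 : ℝ))) ab.1 - (c (Sum.inl ab) : ℝ) / SC| ≤ (w (Sum.inl ab) : ℝ) / SC)
    (η : E3) (hη : ∀ i : Fin 3, |η i - (c (Sum.inr i) : ℝ) / SC| ≤ (w (Sum.inr i) : ℝ) / SC) (Δ : E3) :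
    FI.mem ((deriv (deriv (effPot w₄₅ ω₄ (3 / 400))) ‖cenPt c b‖ - deriv (effPot w₄₅ ω₄ (3 / 400)) ‖cenPt c b‖ / ‖cenPt c b‖) / ‖cenPt c b‖ ^ 2)
        (A0of c b) ∧
      FI.mem (deriv (effPot w₄₅ ω₄ (3 / 400)) ‖cenPt c b‖ / ‖cenPt c b‖) (B0of c b) ∧
      |deriv (effPot w₄₅ ω₄ (3 / 400)) ‖latPt U hexFrame b + U (hcpShift + η)‖ / ‖latPt U hexFrame b + U (hcpShift + η)‖ *
            ⟪latPt U hexFrame b + U (hcpShift + η), Δ⟫ -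
          deriv (effPot w₄₅ ω₄ (3 / 400)) ‖cenPt c b‖ / ‖cenPt c b‖ * ⟪cenPt c b, Δ⟫ -
          ((deriv (deriv (effPot w₄₅ ω₄ (3 / 400))) ‖cenPt c b‖ - deriv (effPot w₄₅ ω₄ (3 / 400)) ‖cenPt c b‖ / ‖cenPt c b‖) / ‖cenPt c b‖ ^ 2 *
              ⟪cenPt c b, latPt U hexFrame b + U (hcpShift + η) - cenPt c b⟫ * ⟪cenPt c b, Δ⟫ +
            deriv (effPot w₄₅ ω₄ (3 / 400)) ‖cenPt c b‖ / ‖cenPt c b‖ * ⟪latPt U hexFrame b + U (hcpShift + η) - cenPt c b, Δ⟫)| ≤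
        ((KSlof c w b : ℤ) : ℝ) / SC / 2 * ((nd2S2 c w b : ℝ) / SC) * ‖Δ‖ := by
  simp only [slopeLabelOK, Bool.and_eq_true] at h
  obtain ⟨htt, hab⟩ := h
  obtain ⟨tt, htt⟩ := Option.isSome_iff_exists.1 htt
  obtain ⟨ab, hab⟩ := Option.isSome_iff_exists.1 hab
  have eA : A0of c b = ab.1 := by simp [A0of, hab]
  have eB : B0of c b = ab.2 := by simp [B0of, hab]
  have eK : KSlof c w b = kSlopeS tt (tube2 c w b) := by simp [KSlof, htt]
  rw [eA, eB, eK]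
  have hab' : coeffFI2 (dot3 (cenVec c b) (cenVec c b)) = some ab := hab
  unfold ttOf2 tripleAt at htt
  cases hB : regBump (tube2 c w b) with
  | true =>
    simp only [hB, ↓reduceIte] at htt
    exact label_slope_bump2 hB htt hab' U hbox η hη Δ
  | false =>
    simp only [hB, Bool.false_eq_true, ↓reduceIte] at htt
    cases hL : regLJ (tube2 c w b) with
    | false => simp [hL] at htt
    | true =>
      simp only [hL, ↓reduceIte] at htt
      exact label_slope_lj2 hL htt hab' U hbox η hη Δ

end Summit.AtomisticToContinuum.Crystallization.Theorems.FrustratedLawDichotomyStrainedPatchHomSlopeCentre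

end
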